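import Mathlib.Analysis.Calculus.BumpFunction.InnerProduct
import Mathlib.Analysis.Calculus.LocalExtr.Basic
import Mathlib.MeasureTheory.Integral.IntegralEqImproper
import Mathlib.MeasureTheory.Measure.Haar.NormedSpace
import HarnessLib

/-!
# K1-Q2 kill-all witness, part 2/4: one-dimensional profiles

Search for candidate a priori estimates; no regularity claim. NS FUNCTIONAL MINING — NO-GO BRANCH
(cell `pub-nsfunc`, no-go seat gen 7).
The vertical profile `Vz(t) = 1 - cos 2πt` with the four exact integrals
`∫₀¹ Vz Vz' = ∫₀¹ Vz Vz'³ = ∫₀¹ V³ Vz' = 0`, `∫₀¹ Vz Vz'² = 2π²` (explicit antiderivatives); the jet profile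
`A` (Mathlib `ContDiffBump` centred at `1/4`, radii `1/16 < 1/8`) and the radial cut-off profile `gc`
(bump centred at `0`, radii `3/16 < 7/32`) with their support facts; `∫ f f' = 0` for compactly
supported `C¹` functions.
Nothing is asserted about Navier–Stokes regularity.
-/

noncomputable section

open MeasureTheory Set Function Filter Topology Metric
open scoped ContDiff Real

namespace Summit.NavierStokesRegularity.FunctionalMining

namespace KillAll

/-! ## One-dimensional profiles

The vertical profile `Vz(t) = 1 - cos 2πt` (smooth, `1`-periodic, `Vz ≥ 0`, `Vz(0) = 0`), the jet
profile `A` (a Mathlib bump centred at `1/4` with radii `1/16 < 1/8`, so `A = 0` off `(1/8, 3/8)` and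
`A(1/4) = 1`) and the radial cut-off profile `gc` (a bump centred at `0` with radii `3/16 < 7/32`). -/

/-- Vertical profile `Vz(t) = 1 - cos (2πt)`. -/
def Vz (t : ℝ) : ℝ := 1 - Real.cos (2 * π * t)

/-- `Vz' (t) = 2π sin (2πt)`. -/
def dVz (t : ℝ) : ℝ := 2 * π * Real.sin (2 * π * t)

/-- Auxiliary declaration `hasDerivAt_two_pi_mul` of the vertical profile V_z and radial bump (file 2/6) (NOGO N11 kill-all chain; search for candidate a priori estimates; no regularity claim). -/
theorem hasDerivAt_two_pi_mul (t : ℝ) : HasDerivAt (fun t : ℝ => 2 * π * t) (2 * π) t := by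
  simpa using (hasDerivAt_id t).const_mul (2 * π)

/-- Auxiliary declaration `hasDerivAt_cos_two_pi_mul` of the vertical profile V_z and radial bump (file 2/6) (NOGO N11 kill-all chain; search for candidate a priori estimates; no regularity claim). -/
theorem hasDerivAt_cos_two_pi_mul (t : ℝ) :
    HasDerivAt (fun t : ℝ => Real.cos (2 * π * t)) (-Real.sin (2 * π * t) * (2 * π)) t :=
  (Real.hasDerivAt_cos _).comp t (hasDerivAt_two_pi_mul t)

/-- Auxiliary declaration `hasDerivAt_sin_two_pi_mul` of the vertical profile V_z and radial bump (file 2/6) (NOGO N11 kill-all chain; search for candidate a priori estimates; no regularity claim). -/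
theorem hasDerivAt_sin_two_pi_mul (t : ℝ) :
    HasDerivAt (fun t : ℝ => Real.sin (2 * π * t)) (Real.cos (2 * π * t) * (2 * π)) t :=
  (Real.hasDerivAt_sin _).comp t (hasDerivAt_two_pi_mul t)

/-- Auxiliary declaration `hasDerivAt_Vz` of the vertical profile V_z and radial bump (file 2/6) (NOGO N11 kill-all chain; search for candidate a priori estimates; no regularity claim). -/
theorem hasDerivAt_Vz (t : ℝ) : HasDerivAt Vz (dVz t) t := by
  have h := (hasDerivAt_const t (1 : ℝ)).sub (hasDerivAt_cos_two_pi_mul t)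
  refine h.congr_deriv ?_
  simp only [dVz]; ring

/-- Auxiliary declaration `deriv_Vz` of the vertical profile V_z and radial bump (file 2/6) (NOGO N11 kill-all chain; search for candidate a priori estimates; no regularity claim). -/
theorem deriv_Vz (t : ℝ) : deriv Vz t = dVz t := (hasDerivAt_Vz t).deriv

/-- Auxiliary declaration `contDiff_Vz` of the vertical profile V_z and radial bump (file 2/6) (NOGO N11 kill-all chain; search for candidate a priori estimates; no regularity claim). -/
theorem contDiff_Vz : ContDiff ℝ ∞ Vz := by unfold Vz; fun_prop

/-- Auxiliary declaration `continuous_Vz` of the vertical profile V_z and radial bump (file 2/6) (NOGO N11 kill-all chain; search for candidate a priori estimates; no regularity claim). -/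
theorem continuous_Vz : Continuous Vz := by unfold Vz; fun_prop

/-- Auxiliary declaration `continuous_dVz` of the vertical profile V_z and radial bump (file 2/6) (NOGO N11 kill-all chain; search for candidate a priori estimates; no regularity claim). -/
theorem continuous_dVz : Continuous dVz := by unfold dVz; fun_prop

/-- Auxiliary declaration `differentiable_Vz` of the vertical profile V_z and radial bump (file 2/6) (NOGO N11 kill-all chain; search for candidate a priori estimates; no regularity claim). -/
theorem differentiable_Vz : Differentiable ℝ Vz := fun t => (hasDerivAt_Vz t).differentiableAt

/-- Auxiliary declaration `Vz_nonneg` of the vertical profile V_z and radial bump (file 2/6) (NOGO N11 kill-all chain; search for candidate a priori estimates; no regularity claim). -/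
theorem Vz_nonneg (t : ℝ) : 0 ≤ Vz t := by
  unfold Vz; linarith [Real.cos_le_one (2 * π * t)]

/-- Auxiliary declaration `Vz_zero` of the vertical profile V_z and radial bump (file 2/6) (NOGO N11 kill-all chain; search for candidate a priori estimates; no regularity claim). -/
theorem Vz_zero : Vz 0 = 0 := by simp [Vz]

/-- Auxiliary declaration `Vz_one` of the vertical profile V_z and radial bump (file 2/6) (NOGO N11 kill-all chain; search for candidate a priori estimates; no regularity claim). -/
theorem Vz_one : Vz 1 = 0 := by simp [Vz]

/-- Auxiliary declaration `Vz_add_one` of the vertical profile V_z and radial bump (file 2/6) (NOGO N11 kill-all chain; search for candidate a priori estimates; no regularity claim). -/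
theorem Vz_add_one (t : ℝ) : Vz (t + 1) = Vz t := by
  unfold Vz; rw [mul_add, mul_one, Real.cos_add_two_pi]

/-- Auxiliary declaration `sin_two_pi_mul_zero` of the vertical profile V_z and radial bump (file 2/6) (NOGO N11 kill-all chain; search for candidate a priori estimates; no regularity claim). -/
theorem sin_two_pi_mul_zero : Real.sin (2 * π * 0) = 0 := by simp

/-- Auxiliary declaration `sin_two_pi_mul_one` of the vertical profile V_z and radial bump (file 2/6) (NOGO N11 kill-all chain; search for candidate a priori estimates; no regularity claim). -/
theorem sin_two_pi_mul_one : Real.sin (2 * π * 1) = 0 := by simp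

/-- Auxiliary declaration `cos_two_pi_mul_zero` of the vertical profile V_z and radial bump (file 2/6) (NOGO N11 kill-all chain; search for candidate a priori estimates; no regularity claim). -/
theorem cos_two_pi_mul_zero : Real.cos (2 * π * 0) = 1 := by simp

/-- Auxiliary declaration `cos_two_pi_mul_one` of the vertical profile V_z and radial bump (file 2/6) (NOGO N11 kill-all chain; search for candidate a priori estimates; no regularity claim). -/
theorem cos_two_pi_mul_one : Real.cos (2 * π * 1) = 1 := by simp

/-- `∫₀¹ Vz Vz' = 0` (antiderivative `V²/2`). [folklore] -/
theorem integral_V_dVz : ∫ t in (0 : ℝ)..1, Vz t * dVz t = 0 := by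
  have h : ∀ t ∈ uIcc (0 : ℝ) 1, HasDerivAt (fun t => Vz t ^ 2 / 2) (Vz t * dVz t) t := fun t _ => by
    have := ((hasDerivAt_Vz t).fun_pow 2).div_const 2
    refine this.congr_deriv ?_
    push_cast; ring
  rw [intervalIntegral.integral_eq_sub_of_hasDerivAt h
    ((continuous_Vz.mul continuous_dVz).intervalIntegrable 0 1)]
  simp [Vz_zero, Vz_one]

/-- `∫₀¹ V³ Vz' = 0` (antiderivative `V⁴/4`). [folklore] -/
theorem integral_V3_dVz : ∫ t in (0 : ℝ)..1, Vz t ^ 3 * dVz t = 0 := by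
  have h : ∀ t ∈ uIcc (0 : ℝ) 1, HasDerivAt (fun t => Vz t ^ 4 / 4) (Vz t ^ 3 * dVz t) t :=
    fun t _ => by
    have := ((hasDerivAt_Vz t).fun_pow 4).div_const 4
    refine this.congr_deriv ?_
    push_cast; ring
  rw [intervalIntegral.integral_eq_sub_of_hasDerivAt h
    (((continuous_Vz.pow 3).mul continuous_dVz).intervalIntegrable 0 1)]
  simp [Vz_zero, Vz_one]

/-- `∫₀¹ Vz Vz'³ = 0` (explicit trigonometric antiderivative). [folklore] -/
theorem integral_V_dV3 : ∫ t in (0 : ℝ)..1, Vz t * dVz t ^ 3 = 0 := by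
  set Φ : ℝ → ℝ := fun t => 4 * π ^ 2 * (-Real.cos (2 * π * t) + Real.cos (2 * π * t) ^ 3 / 3
    - Real.sin (2 * π * t) ^ 4 / 4) with hΦ
  have h : ∀ t ∈ uIcc (0 : ℝ) 1, HasDerivAt Φ (Vz t * dVz t ^ 3) t := fun t _ => by
    have hc := hasDerivAt_cos_two_pi_mul t
    have hs := hasDerivAt_sin_two_pi_mul t
    have := ((hc.neg.add ((hc.fun_pow 3).div_const 3)).sub ((hs.fun_pow 4).div_const 4)).const_mul
      (4 * π ^ 2)
    refine this.congr_deriv ?_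
    simp only [Vz, dVz]
    push_cast
    linear_combination (-(8 * π ^ 3 * Real.sin (2 * π * t))) * Real.sin_sq_add_cos_sq (2 * π * t)
  rw [intervalIntegral.integral_eq_sub_of_hasDerivAt h
    ((continuous_Vz.mul (continuous_dVz.pow 3)).intervalIntegrable 0 1)]
  simp [hΦ]

/-- `∫₀¹ Vz Vz'² = 2π²` (explicit trigonometric antiderivative). [folklore] -/
theorem integral_V_dV2 : ∫ t in (0 : ℝ)..1, Vz t * dVz t ^ 2 = 2 * π ^ 2 := by
  set Ψ : ℝ → ℝ := fun t => 2 * π * (π * t - Real.sin (2 * π * t) * Real.cos (2 * π * t) / 2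
    - Real.sin (2 * π * t) ^ 3 / 3) with hΨ
  have h : ∀ t ∈ uIcc (0 : ℝ) 1, HasDerivAt Ψ (Vz t * dVz t ^ 2) t := fun t _ => by
    have hc := hasDerivAt_cos_two_pi_mul t
    have hs := hasDerivAt_sin_two_pi_mul t
    have ht : HasDerivAt (fun t : ℝ => π * t) π t := by
      simpa using (hasDerivAt_id t).const_mul π
    have := ((ht.sub ((hs.mul hc).div_const 2)).sub ((hs.fun_pow 3).div_const 3)).const_mul (2 * π)
    refine this.congr_deriv ?_
    simp only [Vz, dVz]
    push_cast
    linear_combination (-(2 * π ^ 2)) * Real.sin_sq_add_cos_sq (2 * π * t)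
  rw [intervalIntegral.integral_eq_sub_of_hasDerivAt h
    ((continuous_Vz.mul (continuous_dVz.pow 2)).intervalIntegrable 0 1)]
  simp [hΨ]
  ring

/-- The jet bump: centre `1/4`, radii `1/16 < 1/8`. -/
def jetBump : ContDiffBump (1 / 4 : ℝ) := ⟨1 / 16, 1 / 8, by norm_num, by norm_num⟩

/-- Jet profile `A` (smooth, `0 ≤ A ≤ 1`, `A = 0` off `(1/8, 3/8)`, `A (1/4) = 1`). -/
def A (t : ℝ) : ℝ := jetBump t

/-- Auxiliary declaration `contDiff_A` of the vertical profile V_z and radial bump (file 2/6) (NOGO N11 kill-all chain; search for candidate a priori estimates; no regularity claim). -/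
theorem contDiff_A : ContDiff ℝ ∞ A := jetBump.contDiff

/-- Auxiliary declaration `differentiable_A` of the vertical profile V_z and radial bump (file 2/6) (NOGO N11 kill-all chain; search for candidate a priori estimates; no regularity claim). -/
theorem differentiable_A : Differentiable ℝ A := contDiff_A.differentiable (by simp)

/-- Auxiliary declaration `continuous_A` of the vertical profile V_z and radial bump (file 2/6) (NOGO N11 kill-all chain; search for candidate a priori estimates; no regularity claim). -/
theorem continuous_A : Continuous A := contDiff_A.continuous

/-- Auxiliary declaration `continuous_dA` of the vertical profile V_z and radial bump (file 2/6) (NOGO N11 kill-all chain; search for candidate a priori estimates; no regularity claim). -/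
theorem continuous_dA : Continuous (deriv A) := contDiff_A.continuous_deriv (by simp)

/-- Auxiliary declaration `contDiff_dA` of the vertical profile V_z and radial bump (file 2/6) (NOGO N11 kill-all chain; search for candidate a priori estimates; no regularity claim). -/
theorem contDiff_dA : ContDiff ℝ ∞ (deriv A) := by
  have h : ContDiff ℝ (∞ + 1) A := contDiff_A
  exact (contDiff_succ_iff_deriv.1 h).2.2

/-- Auxiliary declaration `differentiable_dA` of the vertical profile V_z and radial bump (file 2/6) (NOGO N11 kill-all chain; search for candidate a priori estimates; no regularity claim). -/
theorem differentiable_dA : Differentiable ℝ (deriv A) := contDiff_dA.differentiable (by simp)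

/-- Auxiliary declaration `A_nonneg` of the vertical profile V_z and radial bump (file 2/6) (NOGO N11 kill-all chain; search for candidate a priori estimates; no regularity claim). -/
theorem A_nonneg (t : ℝ) : 0 ≤ A t := jetBump.nonneg

/-- Auxiliary declaration `A_le_one` of the vertical profile V_z and radial bump (file 2/6) (NOGO N11 kill-all chain; search for candidate a priori estimates; no regularity claim). -/
theorem A_le_one (t : ℝ) : A t ≤ 1 := jetBump.le_one

/-- Auxiliary declaration `A_center` of the vertical profile V_z and radial bump (file 2/6) (NOGO N11 kill-all chain; search for candidate a priori estimates; no regularity claim). -/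
theorem A_center : A (1 / 4) = 1 :=
  jetBump.one_of_mem_closedBall (Metric.mem_closedBall_self (by norm_num [jetBump]))

/-- Auxiliary declaration `A_eq_zero` of the vertical profile V_z and radial bump (file 2/6) (NOGO N11 kill-all chain; search for candidate a priori estimates; no regularity claim). -/
theorem A_eq_zero {t : ℝ} (h : 1 / 8 ≤ |t - 1 / 4|) : A t = 0 :=
  jetBump.zero_of_le_dist (by rw [Real.dist_eq]; exact h)

/-- Auxiliary declaration `A_three_eighths` of the vertical profile V_z and radial bump (file 2/6) (NOGO N11 kill-all chain; search for candidate a priori estimates; no regularity claim). -/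
theorem A_three_eighths : A (3 / 8) = 0 := A_eq_zero (by norm_num [abs_of_nonneg])

/-- `A' = 0` wherever `A = 0` (a minimum of the nonnegative function `A`). [folklore] -/
theorem dA_eq_zero_of_A_eq_zero {t : ℝ} (h : A t = 0) : deriv A t = 0 :=
  IsLocalMin.deriv_eq_zero (Filter.Eventually.of_forall fun x => by rw [h]; exact A_nonneg x)

/-- Auxiliary declaration `dA_eq_zero` of the vertical profile V_z and radial bump (file 2/6) (NOGO N11 kill-all chain; search for candidate a priori estimates; no regularity claim). -/
theorem dA_eq_zero {t : ℝ} (h : 1 / 8 ≤ |t - 1 / 4|) : deriv A t = 0 :=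
  dA_eq_zero_of_A_eq_zero (A_eq_zero h)

/-- Off `(1/8, 3/8)` both `A` and `A'` vanish. -/
theorem A_dA_eq_zero_of_not {t : ℝ} (h : ¬ |t - 1 / 4| < 1 / 8) : A t = 0 ∧ deriv A t = 0 :=
  ⟨A_eq_zero (not_lt.1 h), dA_eq_zero (not_lt.1 h)⟩

/-- Auxiliary declaration `A_eq_zero_of_nonpos` of the vertical profile V_z and radial bump (file 2/6) (NOGO N11 kill-all chain; search for candidate a priori estimates; no regularity claim). -/
theorem A_eq_zero_of_nonpos {t : ℝ} (h : t ≤ 1 / 8) : A t = 0 :=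
  A_eq_zero (by rw [abs_of_nonpos (by linarith)]; linarith)

/-- Auxiliary declaration `A_eq_zero_of_ge` of the vertical profile V_z and radial bump (file 2/6) (NOGO N11 kill-all chain; search for candidate a priori estimates; no regularity claim). -/
theorem A_eq_zero_of_ge {t : ℝ} (h : 3 / 8 ≤ t) : A t = 0 :=
  A_eq_zero (by rw [abs_of_nonneg (by linarith)]; linarith)

/-- The radial cut-off bump: centre `0`, radii `3/16 < 7/32`. -/
def cutBump : ContDiffBump (0 : ℝ) := ⟨3 / 16, 7 / 32, by norm_num, by norm_num⟩

/-- Radial cut-off profile `gc` (`gc = 1` on `|s| ≤ 3/16`, `gc = 0` on `|s| ≥ 7/32`). -/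
def gc (s : ℝ) : ℝ := cutBump s

/-- Auxiliary declaration `contDiff_gc` of the vertical profile V_z and radial bump (file 2/6) (NOGO N11 kill-all chain; search for candidate a priori estimates; no regularity claim). -/
theorem contDiff_gc : ContDiff ℝ ∞ gc := cutBump.contDiff

/-- Auxiliary declaration `differentiable_gc` of the vertical profile V_z and radial bump (file 2/6) (NOGO N11 kill-all chain; search for candidate a priori estimates; no regularity claim). -/
theorem differentiable_gc : Differentiable ℝ gc := contDiff_gc.differentiable (by simp)

/-- Auxiliary declaration `gc_le_one` of the vertical profile V_z and radial bump (file 2/6) (NOGO N11 kill-all chain; search for candidate a priori estimates; no regularity claim). -/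
theorem gc_le_one (s : ℝ) : gc s ≤ 1 := cutBump.le_one

/-- Auxiliary declaration `gc_eq_one` of the vertical profile V_z and radial bump (file 2/6) (NOGO N11 kill-all chain; search for candidate a priori estimates; no regularity claim). -/
theorem gc_eq_one {s : ℝ} (h : |s| ≤ 3 / 16) : gc s = 1 :=
  cutBump.one_of_mem_closedBall (by simpa [cutBump, Real.dist_eq] using h)

/-- `gc' = 0` wherever `gc = 1` (a maximum of `gc ≤ 1`). [folklore] -/
theorem dgc_eq_zero {s : ℝ} (h : |s| ≤ 3 / 16) : deriv gc s = 0 :=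
  IsLocalMax.deriv_eq_zero (Filter.Eventually.of_forall fun x => by
    rw [gc_eq_one h]; exact gc_le_one x)

/-- Auxiliary declaration `gc_eq_zero` of the vertical profile V_z and radial bump (file 2/6) (NOGO N11 kill-all chain; search for candidate a priori estimates; no regularity claim). -/
theorem gc_eq_zero {s : ℝ} (h : 7 / 32 ≤ |s|) : gc s = 0 :=
  cutBump.zero_of_le_dist (by simpa [cutBump, Real.dist_eq] using h)

/-! ## Profile integrals -/

/-- `∫ f f' = 0` for a `C¹` function with compact support. [folklore] -/
theorem integral_mul_deriv_eq_zero {f : ℝ → ℝ} (hf : ContDiff ℝ 1 f) (hs : HasCompactSupport f) :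
    ∫ t, f t * deriv f t = 0 := by
  have hd : ∀ t, HasDerivAt (fun t => f t ^ 2 / 2) (f t * deriv f t) t := fun t => by
    have := ((hf.differentiable one_ne_zero t).hasDerivAt.fun_pow 2).div_const 2
    refine this.congr_deriv ?_
    push_cast; ring
  have hc : Continuous f := hf.continuous
  have hc' : Continuous (deriv f) := hf.continuous_deriv le_rfl
  refine integral_eq_zero_of_hasDerivAt_of_integrable hd ?_ ?_
  · exact (hc.mul hc').integrable_of_hasCompactSupport hs.deriv.mul_left
  · exact ((hc.pow 2).div_const 2).integrable_of_hasCompactSupport (by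
      refine HasCompactSupport.intro (K := tsupport f) hs fun t ht => ?_
      simp [image_eq_zero_of_notMem_tsupport ht])


end KillAll

end Summit.NavierStokesRegularity.FunctionalMining

end
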